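import Summits.BirchSwinnertonDyer.BirchSwinnertonDyer.Theorems.AdditiveKolyvaginRoadRamifiedHabitatSignLawStarred
import HarnessLib

/-!
# Route `AdditiveKolyvaginRoad`, crux KS′ `LevelKolyvaginSystemsAdditive` (stmt-BirchSwinnertonDyer-21396), card `ramified-toric-habitat` —
# part 7: ONE multiplicative prime INERT flips the sign — the Shimura-curve habitat `X^{pq₀}` of the card's rank-one rows

Cell `pub/bsd-wall`, width seat `bsd-wall-akr-p2x-w2` g11; `--supports stmt-BirchSwinnertonDyer-21396` (helper). THEOREMS ONLY; no definition,
no named fact, no `sorry`. BSD is not proved by any of this; KS′/KPA′ stay OPEN at `p² ∣ N`.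

The card's (T3), PART A column 3: in the `p`-ramified habitat, making ONE multiplicative prime `q₀` INERT instead of split flips
`w(E)·w(E^{(d)})`, so the supercuspidal rows get sign `−1` (Shimura curve `X^{pq₀}`, the habitat of the analytic-rank-one rows) and the
potentially good principal-series rows get `+1`. In the tree's currency (parts 1–6):

* `localRootNumber_mul_pStarTwist_padic_of_mem` — parts 1 and 5 in one statement (`a ∈ {2,3,4,8,9,10}`; product `1` iff `a ≡ 3 (6)`, i.e. `e = 4`).
* `jacobiSym_natAbs_eq_neg_legendreSym_of_inert` / `…_of_one_inert` — `(q₀/|d'|) = −(q₀/p)` at an inert odd `q₀`, hence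
  `(M/|d'|) = −(M/p)` when exactly one odd prime of the squarefree `M` is inert and the others split.
* `rootNumber_mul_rootNumber_ramifiedTwist_of_localData_of_one_inert` — `w(E)·w(E^{(d)}) = +(−1/p)·W_p(E)W_p(E^{(p*)})` (sign flipped w.r.t.
  part 6's all-split `−(−1/p)·…`), local data at `p` as hypotheses.
* `rootNumber_mul_rootNumber_ramifiedTwist_of_one_inert_eq_neg_one_of_not_dvd` (`e ∤ p − 1 ⟹ −1`) and `…_eq_one_of_dvd` (`e ∣ p − 1 ⟹ +1`),
  for all six Kodaira types with `e ∈ {3,4,6}`.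

Scope as in parts 3–6: `N = M p²` with `M` squarefree, `d = p*·d'` odd, the inert prime odd; CONDITIONAL on the Modularity Theorem and
Kellock–Dokchitser's Rem. 2.2 at `p` for `E`, `E^{(p*)}`.

References: [cite: MurtyMurty1997, Ch. 6 §1] [cite: Rohrlich1993Compositio, Prop. 2(iv)] [cite: KellockDokchitser2023, Rem. 2.2].
-/

set_option autoImplicit false
set_option linter.dupNamespace false

noncomputable section

open scoped Classical MatrixGroups

open CongruenceSubgroup IsDedekindDomain IsDedekindDomain.HeightOneSpectrum NumberField Rat.HeightOneSpectrum
  WeierstrassCurve Literature.NumberTheory.EllipticCurves Literature.NumberTheory.EllipticCurves.ModularForms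
  IsDiscreteValuationRing

namespace Summit.BirchSwinnertonDyer.BirchSwinnertonDyer.Theorems.AdditiveKoly.RamifiedHabitat

/-! ## §8 One multiplicative prime INERT: the sign flips (the Shimura-curve habitat `X^{pq₀}` of the rank-one rows) -/

section Inert

open scoped NumberTheorySymbols

variable {p : ℕ} [Fact p.Prime]

/-- The two local tables at `p` in one statement: for `a = ord_p Δ_min ∈ {2,3,4,8,9,10}` (types II, III, IV, IV*, III*, II*; `e = 12/gcd(12,a)`),
additive potentially good, both minimal models are additive and `W_p(E)·W_p(E^{(p*)}) = 1` if `e = 4` (`a ≡ 3 (6)`), `= (−1/p)(−3/p)` otherwise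
(parts 1 and 5). [cite: Rohrlich1993Compositio, Prop. 2(iv)] -/
theorem localRootNumber_mul_pStarTwist_padic_of_mem (W : WeierstrassCurve ℚ) [W.IsElliptic] (hp5 : 5 ≤ p) {a : ℕ}
    (hΔ : addVal ℤ_[p] (((W.baseChange ℚ_[p]).minimal ℤ_[p]).integralModel ℤ_[p]).Δ = a)
    (ha : a = 2 ∨ a = 3 ∨ a = 4 ∨ a = 8 ∨ a = 9 ∨ a = 10)
    (hc₄ : addVal ℤ_[p] (((W.baseChange ℚ_[p]).minimal ℤ_[p]).integralModel ℤ_[p]).c₄ ≠ 0)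
    (hj : ¬ 3 * addVal ℤ_[p] (((W.baseChange ℚ_[p]).minimal ℤ_[p]).integralModel ℤ_[p]).c₄ <
      addVal ℤ_[p] (((W.baseChange ℚ_[p]).minimal ℤ_[p]).integralModel ℤ_[p]).Δ) :
    ((W.baseChange ℚ_[p]).minimal ℤ_[p]).HasAdditiveReduction ℤ_[p] ∧
      (((W.quadraticTwist (((-1 : ℤ) ^ (p / 2) * p : ℤ) : ℚ)).baseChange ℚ_[p]).minimal ℤ_[p]).HasAdditiveReduction
        ℤ_[p] ∧
      (W.baseChange ℚ_[p]).localRootNumber ℤ_[p] *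
          ((W.quadraticTwist (((-1 : ℤ) ^ (p / 2) * p : ℤ) : ℚ)).baseChange ℚ_[p]).localRootNumber ℤ_[p] =
        if a % 6 = 3 then 1 else ZMod.χ₄ p * (if p % 3 = 1 then 1 else -1) := by
  rcases ha with h | h | h | h | h | h
  · obtain ⟨h1, h2, h3⟩ := localRootNumber_mul_pStarTwist_padic W hp5 hΔ (Or.inl h) hc₄ hj
    exact ⟨h1, h2, by rw [h3]; subst h; rfl⟩
  · obtain ⟨h1, h2, h3⟩ := localRootNumber_mul_pStarTwist_padic W hp5 hΔ (Or.inr (Or.inl h)) hc₄ hj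
    exact ⟨h1, h2, by rw [h3]; subst h; rfl⟩
  · obtain ⟨h1, h2, h3⟩ := localRootNumber_mul_pStarTwist_padic W hp5 hΔ (Or.inr (Or.inr h)) hc₄ hj
    exact ⟨h1, h2, by rw [h3]; subst h; rfl⟩
  · obtain ⟨h1, h2, h3⟩ := localRootNumber_mul_pStarTwist_padic_of_ge W hp5 hΔ (Or.inl h) hc₄ hj
    exact ⟨h1, h2, by rw [h3]; subst h; rfl⟩
  · obtain ⟨h1, h2, h3⟩ := localRootNumber_mul_pStarTwist_padic_of_ge W hp5 hΔ (Or.inr (Or.inl h)) hc₄ hj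
    exact ⟨h1, h2, by rw [h3]; subst h; rfl⟩
  · obtain ⟨h1, h2, h3⟩ := localRootNumber_mul_pStarTwist_padic_of_ge W hp5 hΔ (Or.inr (Or.inr h)) hc₄ hj
    exact ⟨h1, h2, by rw [h3]; subst h; rfl⟩

/-- At an odd prime `q` INERT in `ℚ(√d)`, `d = p*·d'` (`(d/q) = −1`): `(q / |d'|) = −(q/p)` (as in the split case, with `(p*/q)(d'/q) = −1`).
[folklore] -/
theorem jacobiSym_natAbs_eq_neg_legendreSym_of_inert (hp2 : p ≠ 2) {d' : ℤ} (hd'4 : d' % 4 = 1) {q : ℕ} [Fact q.Prime]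
    (hq2 : q ≠ 2) (hinert : J((-1 : ℤ) ^ (p / 2) * p * d' | q) = -1) :
    J((q : ℤ) | d'.natAbs) = -legendreSym p q := by
  have hqodd : Odd q := (Nat.Prime.eq_two_or_odd' (Fact.out : q.Prime)).resolve_left hq2
  rw [Literature.NumberTheory.QuadraticFields.jacobiSym_natAbs_eq_of_emod_four_eq_one hd'4 hqodd, ← legendreSym_pStar hp2 hq2,
    jacobiSym.legendreSym.to_jacobiSym]
  rw [jacobiSym.mul_left] at hinert
  set A := J((-1 : ℤ) ^ (p / 2) * p | q)
  set B := J(d' | q)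
  haveI : NeZero q := ⟨(Fact.out : q.Prime).ne_zero⟩
  have hA0 : A ≠ 0 := fun h ↦ by rw [h, zero_mul] at hinert; norm_num at hinert
  have hA2 : A * A = 1 := by
    rw [← sq]
    exact jacobiSym.sq_one (by by_contra h; exact hA0 (jacobiSym.eq_zero_iff_not_coprime.mpr h))
  calc B = A * (A * B) := by rw [← mul_assoc, hA2, one_mul]
    _ = -A := by rw [hinert, mul_neg_one]

/-- `(M / |d'|) = −(M/p)` for squarefree `M` when exactly ONE odd prime `q₀ ∣ M` is INERT in `ℚ(√d)` (`d = p*·d'`) and every other prime of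
`M` splits. [folklore] -/
theorem jacobiSym_natAbs_eq_neg_legendreSym_of_one_inert (hp2 : p ≠ 2) {d' : ℤ} (hd'4 : d' % 4 = 1) {M : ℕ} (hM : Squarefree M)
    {q₀ : ℕ} (hq₀ : q₀ ∈ M.primeFactors) (hq₀2 : q₀ ≠ 2) (hinert : J((-1 : ℤ) ^ (p / 2) * p * d' | q₀) = -1)
    (hodd : ∀ q ∈ M.primeFactors, q ≠ q₀ → q ≠ 2 → J((-1 : ℤ) ^ (p / 2) * p * d' | q) = 1)
    (htwo : 2 ∣ M → ((-1 : ℤ) ^ (p / 2) * p * d') % 8 = 1) :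
    J((M : ℤ) | d'.natAbs) = -legendreSym p M := by
  let φ : ℤ →* ℤ :=
    { toFun := fun a ↦ jacobiSym a d'.natAbs
      map_one' := jacobiSym.one_left _
      map_mul' := fun a b ↦ jacobiSym.mul_left a b _ }
  have hφ : ∀ a : ℤ, φ a = J(a | d'.natAbs) := fun _ ↦ rfl
  conv_lhs => rw [← Nat.prod_primeFactors_of_squarefree hM, Nat.cast_prod, ← hφ, map_prod, ← Finset.mul_prod_erase _ _ hq₀]
  conv_rhs => rw [← Nat.prod_primeFactors_of_squarefree hM, Nat.cast_prod, ← legendreSym.hom_apply, map_prod,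
    ← Finset.mul_prod_erase _ _ hq₀]
  haveI := Fact.mk (Nat.prime_of_mem_primeFactors hq₀)
  rw [hφ, legendreSym.hom_apply, jacobiSym_natAbs_eq_neg_legendreSym_of_inert hp2 hd'4 hq₀2 hinert, neg_mul]
  congr 2
  refine Finset.prod_congr rfl fun q hq ↦ ?_
  have hqq₀ : q ≠ q₀ := Finset.ne_of_mem_erase hq
  have hqM : q ∈ M.primeFactors := Finset.mem_of_mem_erase hq
  rw [hφ, legendreSym.hom_apply]
  haveI := Fact.mk (Nat.prime_of_mem_primeFactors hqM)
  by_cases hq2 : q = 2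
  · subst hq2
    exact jacobiSym_two_natAbs_eq_legendreSym_of_split hp2 hd'4 (htwo (Nat.dvd_of_mem_primeFactors hqM))
  · exact jacobiSym_natAbs_eq_legendreSym_of_split_odd hp2 hd'4 hq2 (hodd q hqM hqq₀ hq2)

/-- **ONE INERT PRIME FLIPS THE SIGN.** Local data at `p` as hypotheses (`W_p(E)·W_p(E^{(p*)}) = r`, both minimal models additive); habitat
`d = p*·d'` (`d' ≡ 1 (4)` squarefree, prime to `N`, `d < 0`) in which exactly one odd prime `q₀ ∣ M` is INERT and every other prime of `M`
splits: then `w(E)·w(E^{(d)}) = +(−1/p)·r` — the opposite of the all-split habitat (card `ramified-toric-habitat`, T3: the Shimura curve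
`X^{pq₀}` for the rank-one rows). Conditional on {hmod, F1 at `p`}. [cite: MurtyMurty1997, Ch. 6 §1] [cite: KellockDokchitser2023, Rem. 2.2] -/
theorem rootNumber_mul_rootNumber_ramifiedTwist_of_localData_of_one_inert (W : WeierstrassCurve ℚ) [W.IsElliptic]
    (hmod : exists_isNewformOf) (hF1 : W.atkinLehnerEigenvalueAt_eq_localRootNumberAt)
    (hF1' : (W.quadraticTwist (((-1 : ℤ) ^ (p / 2) * p : ℤ) : ℚ)).atkinLehnerEigenvalueAt_eq_localRootNumberAt)
    (hp5 : 5 ≤ p) {M : ℕ} (hN : W.conductorNorm ℤ = M * p ^ 2) (hM : Squarefree M) (hpM : ¬ p ∣ M)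
    (hadd : ((W.baseChange ℚ_[p]).minimal ℤ_[p]).HasAdditiveReduction ℤ_[p])
    (hadd' : (((W.quadraticTwist (((-1 : ℤ) ^ (p / 2) * p : ℤ) : ℚ)).baseChange ℚ_[p]).minimal
      ℤ_[p]).HasAdditiveReduction ℤ_[p]) {r : ℤ}
    (hprod : (W.baseChange ℚ_[p]).localRootNumber ℤ_[p] *
      ((W.quadraticTwist (((-1 : ℤ) ^ (p / 2) * p : ℤ) : ℚ)).baseChange ℚ_[p]).localRootNumber ℤ_[p] = r)
    {d' : ℤ} (hd'4 : d' % 4 = 1) (hd'sq : Squarefree d') (hgcd : Int.gcd d' (W.conductorNorm ℤ) = 1)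
    (hneg : (-1 : ℤ) ^ (p / 2) * p * d' < 0)
    {q₀ : ℕ} (hq₀ : q₀ ∈ M.primeFactors) (hq₀2 : q₀ ≠ 2) (hinert : J((-1 : ℤ) ^ (p / 2) * p * d' | q₀) = -1)
    (hodd : ∀ q ∈ M.primeFactors, q ≠ q₀ → q ≠ 2 → J((-1 : ℤ) ^ (p / 2) * p * d' | q) = 1)
    (htwo : 2 ∣ M → ((-1 : ℤ) ^ (p / 2) * p * d') % 8 = 1) :
    W.rootNumber * (W.quadraticTwist (((-1 : ℤ) ^ (p / 2) * p * d' : ℤ) : ℚ)).rootNumber = ZMod.χ₄ p * r := by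
  have hp : p.Prime := Fact.out
  have hp2 : p ≠ 2 := by omega
  have hdZ0 : ((-1 : ℤ) ^ (p / 2) * p : ℤ) ≠ 0 :=
    mul_ne_zero (pow_ne_zero _ (by norm_num)) (by exact_mod_cast hp.ne_zero)
  have hd0 : (((((-1 : ℤ) ^ (p / 2) * p : ℤ)) : ℚ)) ≠ 0 := by exact_mod_cast hdZ0
  haveI hE' : (W.quadraticTwist (((-1 : ℤ) ^ (p / 2) * p : ℤ) : ℚ)).IsElliptic := W.isElliptic_quadraticTwist hd0
  have hA := rootNumber_mul_rootNumber_pStarTwist_of_localData W hmod hF1 hF1' hp5 hN hM hpM hadd hadd' hprod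
  have hN' : (W.quadraticTwist (((-1 : ℤ) ^ (p / 2) * p : ℤ) : ℚ)).conductorNorm ℤ = M * p ^ 2 :=
    (conductorNorm_pStarTwist_eq W hp5 hadd hadd').trans hN
  have hgcd' : Int.gcd d' ((W.quadraticTwist (((-1 : ℤ) ^ (p / 2) * p : ℤ) : ℚ)).conductorNorm ℤ) = 1 := by
    rw [hN', ← hN]; exact hgcd
  have hB := ((W.quadraticTwist (((-1 : ℤ) ^ (p / 2) * p : ℤ) : ℚ)).rootNumber_quadraticTwist_of_emod_four_eq_one
    hmod hd'4 hd'sq hgcd').1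
  rw [quadraticTwist_quadraticTwist, hN'] at hB
  have hcast : ((((-1 : ℤ) ^ (p / 2) * p : ℤ) : ℚ)) * (d' : ℚ) = (((-1 : ℤ) ^ (p / 2) * p * d' : ℤ) : ℚ) := by push_cast; ring
  rw [hcast] at hB
  have hNe0 : NeZero d'.natAbs := ⟨Int.natAbs_ne_zero.mpr (by rintro rfl; norm_num at hd'4)⟩
  have hJM : J(((M * p ^ 2 : ℕ) : ℤ) | d'.natAbs) = -legendreSym p M := by
    rw [Nat.cast_mul, jacobiSym.mul_left, jacobiSym_natAbs_eq_neg_legendreSym_of_one_inert hp2 hd'4 hM hq₀ hq₀2 hinert hodd htwo,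
      Nat.cast_pow, jacobiSym.sq_one', mul_one]
    rw [Int.gcd_natCast_natCast]
    have h1 : Nat.Coprime d'.natAbs (W.conductorNorm ℤ) := by
      have := hgcd; unfold Int.gcd at this; simpa using this
    have hpN : p ∣ W.conductorNorm ℤ := by rw [hN]; exact ⟨M * p, by ring⟩
    exact (Nat.Coprime.coprime_dvd_right hpN h1).symm
  have hJ1 := jacobiSym_neg_one_natAbs_eq_of_neg hp2 hd'4 hneg
  have hM2 : legendreSym p M * legendreSym p M = 1 := by
    rw [← sq]
    refine legendreSym.sq_one p ?_
    rw [Int.cast_natCast, ne_eq, ZMod.natCast_eq_zero_iff]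
    exact hpM
  calc W.rootNumber * (W.quadraticTwist (((-1 : ℤ) ^ (p / 2) * p * d' : ℤ) : ℚ)).rootNumber
      = J(-1 | d'.natAbs) * J(((M * p ^ 2 : ℕ) : ℤ) | d'.natAbs) *
          (W.rootNumber * (W.quadraticTwist (((-1 : ℤ) ^ (p / 2) * p : ℤ) : ℚ)).rootNumber) := by rw [hB]; ring
    _ = -ZMod.χ₄ p * (-legendreSym p M) * (legendreSym p M * r) := by rw [hJ1, hJM, hA]
    _ = ZMod.χ₄ p * r := by linear_combination (ZMod.χ₄ ↑p * r) * hM2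

/-- **SHIMURA-CURVE HABITAT: supercuspidal type, ONE multiplicative prime inert ⟹ sign `−1`.** `E` semistable away from `p`, additive potentially
good at `p ≥ 5` of Kodaira type II/III/IV/IV*/III*/II* (`a = ord_pΔ_min`, `e = 12/gcd(12,a) ∈ {3,4,6}`), `e ∤ p − 1`; `d = p*·d'` odd with `p`
ramified, exactly one odd `q₀ ∣ M` inert, all other primes of `M` split. Then `w(E)·w(E^{(d)}) = −1` (card `ramified-toric-habitat`, T3 / PART A
col. 3: the habitat of the rank-one rows is the Shimura curve `X^{pq₀}`). Conditional on {hmod, F1 at `p`}; BSD is not proved by this.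
[cite: Rohrlich1993Compositio, Prop. 2(iv)] [cite: KellockDokchitser2023, Rem. 2.2] -/
theorem rootNumber_mul_rootNumber_ramifiedTwist_of_one_inert_eq_neg_one_of_not_dvd (W : WeierstrassCurve ℚ) [W.IsElliptic]
    (hmod : exists_isNewformOf) (hF1 : W.atkinLehnerEigenvalueAt_eq_localRootNumberAt)
    (hF1' : (W.quadraticTwist (((-1 : ℤ) ^ (p / 2) * p : ℤ) : ℚ)).atkinLehnerEigenvalueAt_eq_localRootNumberAt)
    (hp5 : 5 ≤ p) {M : ℕ} (hN : W.conductorNorm ℤ = M * p ^ 2) (hM : Squarefree M) (hpM : ¬ p ∣ M) {a : ℕ}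
    (hΔ : addVal ℤ_[p] (((W.baseChange ℚ_[p]).minimal ℤ_[p]).integralModel ℤ_[p]).Δ = a)
    (ha : a = 2 ∨ a = 3 ∨ a = 4 ∨ a = 8 ∨ a = 9 ∨ a = 10)
    (hc₄ : addVal ℤ_[p] (((W.baseChange ℚ_[p]).minimal ℤ_[p]).integralModel ℤ_[p]).c₄ ≠ 0)
    (hj : ¬ 3 * addVal ℤ_[p] (((W.baseChange ℚ_[p]).minimal ℤ_[p]).integralModel ℤ_[p]).c₄ <
      addVal ℤ_[p] (((W.baseChange ℚ_[p]).minimal ℤ_[p]).integralModel ℤ_[p]).Δ)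
    {d' : ℤ} (hd'4 : d' % 4 = 1) (hd'sq : Squarefree d') (hgcd : Int.gcd d' (W.conductorNorm ℤ) = 1)
    (hneg : (-1 : ℤ) ^ (p / 2) * p * d' < 0)
    {q₀ : ℕ} (hq₀ : q₀ ∈ M.primeFactors) (hq₀2 : q₀ ≠ 2) (hinert : J((-1 : ℤ) ^ (p / 2) * p * d' | q₀) = -1)
    (hodd : ∀ q ∈ M.primeFactors, q ≠ q₀ → q ≠ 2 → J((-1 : ℤ) ^ (p / 2) * p * d' | q) = 1)
    (htwo : 2 ∣ M → ((-1 : ℤ) ^ (p / 2) * p * d') % 8 = 1)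
    (hsc : ¬ 12 / Nat.gcd a 12 ∣ p - 1) :
    W.rootNumber * (W.quadraticTwist (((-1 : ℤ) ^ (p / 2) * p * d' : ℤ) : ℚ)).rootNumber = -1 := by
  have hp2 : p ≠ 2 := by omega
  obtain ⟨hadd, hadd', hprod⟩ := localRootNumber_mul_pStarTwist_padic_of_mem W hp5 hΔ ha hc₄ hj
  rw [rootNumber_mul_rootNumber_ramifiedTwist_of_localData_of_one_inert W hmod hF1 hF1' hp5 hN hM hpM hadd hadd' hprod hd'4 hd'sq hgcd
    hneg hq₀ hq₀2 hinert hodd htwo]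
  have hp' := (Nat.Prime.eq_two_or_odd (Fact.out : p.Prime)).resolve_left hp2
  have hχ₄ : ZMod.χ₄ p * ZMod.χ₄ p = 1 := by
    rw [ZMod.χ₄_nat_eq_if_mod_four]
    have : p % 4 = 1 ∨ p % 4 = 3 := by omega
    have h2' : p % 2 ≠ 0 := by omega
    rcases this with h | h <;> simp [h, h2']
  by_cases h6 : a % 6 = 3
  · -- `e = 4 ∤ p − 1 ⟹ p ≡ 3 (4)`
    have e4 : 12 / Nat.gcd a 12 = 4 := by
      rcases ha with rfl | rfl | rfl | rfl | rfl | rfl <;> simp_all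
    rw [e4] at hsc
    have h4 : p % 4 = 3 := by omega
    rw [if_pos h6, mul_one, ZMod.χ₄_nat_three_mod_four h4]
  · -- `e ∈ {3, 6}`, `e ∤ p − 1 ⟹ p ≢ 1 (3)`
    have h3 : p % 3 ≠ 1 := by
      intro h3
      rcases ha with rfl | rfl | rfl | rfl | rfl | rfl <;> simp_all <;> omega
    rw [if_neg h6, if_neg h3, ← mul_assoc, hχ₄]
    norm_num

/-- **… and principal-series type (`e ∣ p − 1`, potentially good), one inert prime ⟹ sign `+1`.** Conditional on {hmod, F1 at `p`}.
[cite: Rohrlich1993Compositio, Prop. 2(iv)] [cite: KellockDokchitser2023, Rem. 2.2] -/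
theorem rootNumber_mul_rootNumber_ramifiedTwist_of_one_inert_eq_one_of_dvd (W : WeierstrassCurve ℚ) [W.IsElliptic]
    (hmod : exists_isNewformOf) (hF1 : W.atkinLehnerEigenvalueAt_eq_localRootNumberAt)
    (hF1' : (W.quadraticTwist (((-1 : ℤ) ^ (p / 2) * p : ℤ) : ℚ)).atkinLehnerEigenvalueAt_eq_localRootNumberAt)
    (hp5 : 5 ≤ p) {M : ℕ} (hN : W.conductorNorm ℤ = M * p ^ 2) (hM : Squarefree M) (hpM : ¬ p ∣ M) {a : ℕ}
    (hΔ : addVal ℤ_[p] (((W.baseChange ℚ_[p]).minimal ℤ_[p]).integralModel ℤ_[p]).Δ = a)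
    (ha : a = 2 ∨ a = 3 ∨ a = 4 ∨ a = 8 ∨ a = 9 ∨ a = 10)
    (hc₄ : addVal ℤ_[p] (((W.baseChange ℚ_[p]).minimal ℤ_[p]).integralModel ℤ_[p]).c₄ ≠ 0)
    (hj : ¬ 3 * addVal ℤ_[p] (((W.baseChange ℚ_[p]).minimal ℤ_[p]).integralModel ℤ_[p]).c₄ <
      addVal ℤ_[p] (((W.baseChange ℚ_[p]).minimal ℤ_[p]).integralModel ℤ_[p]).Δ)
    {d' : ℤ} (hd'4 : d' % 4 = 1) (hd'sq : Squarefree d') (hgcd : Int.gcd d' (W.conductorNorm ℤ) = 1)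
    (hneg : (-1 : ℤ) ^ (p / 2) * p * d' < 0)
    {q₀ : ℕ} (hq₀ : q₀ ∈ M.primeFactors) (hq₀2 : q₀ ≠ 2) (hinert : J((-1 : ℤ) ^ (p / 2) * p * d' | q₀) = -1)
    (hodd : ∀ q ∈ M.primeFactors, q ≠ q₀ → q ≠ 2 → J((-1 : ℤ) ^ (p / 2) * p * d' | q) = 1)
    (htwo : 2 ∣ M → ((-1 : ℤ) ^ (p / 2) * p * d') % 8 = 1)
    (hps : 12 / Nat.gcd a 12 ∣ p - 1) :
    W.rootNumber * (W.quadraticTwist (((-1 : ℤ) ^ (p / 2) * p * d' : ℤ) : ℚ)).rootNumber = 1 := by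
  have hp2 : p ≠ 2 := by omega
  obtain ⟨hadd, hadd', hprod⟩ := localRootNumber_mul_pStarTwist_padic_of_mem W hp5 hΔ ha hc₄ hj
  rw [rootNumber_mul_rootNumber_ramifiedTwist_of_localData_of_one_inert W hmod hF1 hF1' hp5 hN hM hpM hadd hadd' hprod hd'4 hd'sq hgcd
    hneg hq₀ hq₀2 hinert hodd htwo]
  have hp' := (Nat.Prime.eq_two_or_odd (Fact.out : p.Prime)).resolve_left hp2
  have hχ₄ : ZMod.χ₄ p * ZMod.χ₄ p = 1 := by
    rw [ZMod.χ₄_nat_eq_if_mod_four]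
    have : p % 4 = 1 ∨ p % 4 = 3 := by omega
    have h2' : p % 2 ≠ 0 := by omega
    rcases this with h | h <;> simp [h, h2']
  by_cases h6 : a % 6 = 3
  · have e4 : 12 / Nat.gcd a 12 = 4 := by
      rcases ha with rfl | rfl | rfl | rfl | rfl | rfl <;> simp_all
    rw [e4] at hps
    have h4 : p % 4 = 1 := by omega
    rw [if_pos h6, mul_one, ZMod.χ₄_nat_one_mod_four h4]
  · have h3 : p % 3 = 1 := by
      rcases ha with rfl | rfl | rfl | rfl | rfl | rfl <;> simp_all <;> omega
    rw [if_neg h6, if_pos h3, ← mul_assoc, hχ₄, one_mul]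

end Inert

end Summit.BirchSwinnertonDyer.BirchSwinnertonDyer.Theorems.AdditiveKoly.RamifiedHabitat

end
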